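import Literature.Claims.NS.ClayPeriodicSerrinBridge
import Literature.Analysis.FluidPDE.TorusWeakStrongUniqueness
import Literature.Analysis.FluidPDE.NSHopfExistenceProofs
import Literature.Analysis.FunctionSpaces.TorusCalculusProofs
import HarnessLib

/-!
# Clay (B) reference — the Leray–Hopf / Serrin `L^∞` form: (B) ⇔ every torus Leray–Hopf weak solution
# from a smooth divergence-free datum is essentially bounded below every positive time (from the left)

Companion to `ClayPeriodicSerrinBridge.lean` ((B) ⇔ a priori bounds along CLASSICAL periodic solutions).
Claimed proofs of the periodic problem are often typed over Leray–Hopf WEAK solutions on `𝕋³` (the cell's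
rows C13b `Kampen2015`, C129 `Nadirashvili2026`, C85 …): their natural Clay link is «every Leray–Hopf weak
solution from smooth data is (essentially) bounded near every time ⇒ (B)», i.e. Serrin's `L^∞_t L^∞_x`
criterion in the datum-wise form, combined with Hopf's existence theorem and Sather–Serrin weak–strong
uniqueness. All three ingredients are THEOREMS of the tree on `𝕋³`:
`hopf_existence_torus_holds` (Hopf 1951 / Galerkin), `Torus.IsLerayHopfOn.ae_eq_of_isClassicalNSSolutionOn`
(Robinson–Rodrigo–Sadowski 2016 Thm. 6.10), and the velocity blow-up alternative of
`ClayPeriodicSerrinBridge.lean` (`not_clayPeriodic_solvable_iff_exists_velocitySupBlowup`, RRS Thm. 8.17 /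
Lemma 8.16 with §6.3, §8.1). This file assembles them:

* `clayPeriodic_solvable_of_lerayHopf_boundedFromLeft` — **per-datum door**: for `ν > 0` and a smooth
  divergence-free `ℤ³`-periodic datum `u₀` on `ℝ³`, if EVERY global Leray–Hopf weak solution `w` of the
  unforced equations on `𝕋³` from the descended datum `u₀ ∘ repr` is, below every time `T > 0`,
  essentially bounded on some `(t₁, T) × 𝕋³` (`t₁ < T`), then `(ν, 0, u₀)` is solvable in Fefferman's
  printed class (10). (If not, the maximal periodic classical solution blows up in sup norm at `T*`;
  Hopf's weak solution from the same datum coincides with it a.e. on `(0, T*)` by weak–strong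
  uniqueness, so an essential bound on `(t₁, T*) × 𝕋³` bounds the classical solution there —
  continuity turns «a.e.» into «everywhere» — contradicting the blow-up.)
* `clayPeriodic_regularityAt_iff_lerayHopf_boundedFromLeft` / `clayPeriodic_regularity_iff_…(_at)` —
  **(B) ⇔ the datum-wise Serrin `L^∞` criterion for Leray–Hopf solutions on `𝕋³`** ((⇒): the global
  classical solution given by (B), read on the torus via `clayPeriodic_solvable_zero_iff_torus`, is
  bounded on compact time intervals and every Leray–Hopf solution from the datum equals it a.e.,
  `Torus.IsGlobalLerayHopf.ae_eq_of_isClassicalNSSolutionOn_Ici`).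

Usage on a CARD (§3, periodic rows typed over Leray–Hopf solutions): a printed «every Leray–Hopf solution
from smooth data is bounded (from the left) near every time» IS (B) —
cite `clayPeriodic_regularity_iff_lerayHopf_boundedFromLeft`; what stays a delta is a data class wider than
smooth (Δ4: `L²`/`H^s` data — (B)-STRONGER), forcing (Δ3), `ν = 0` (Δ2).

## References

* C. L. Fefferman, CMI 2006, (B) with (8), (10), (11) p. 2. [FeffermanClay2006]
* J. Serrin, Arch. Rational Mech. Anal. 9 (1962) 187–195 (the `L^∞` case of the `L^q_tL^r_x` criterion).
  [Serrin1962]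
* J. C. Robinson, J. L. Rodrigo, W. Sadowski, CUP 2016, Thm. 6.10 (weak–strong uniqueness), Thm. 4.10 /
  Thm. 6.5 (Hopf / strong ⇒ Leray–Hopf), Thm. 8.17 with Lemma 8.16, §6.3, §8.1. [RobinsonRodrigoSadowskiCUP2016]
* E. Hopf, Math. Nachr. 4 (1951) 213–231. [Hopf1951]

WHAT THIS IS NOT: not a claim about NS regularity or blow-up; not a claim about any author beyond
the typed locator.
-/

open scoped ContDiff ENNReal Topology

namespace Literature.Claims.NS.ClayVariants

open Set Filter MeasureTheory Function Literature.Analysis Literature.Analysis.FluidPDE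
  Literature.Analysis.FunctionSpaces

noncomputable section

variable {ν : ℝ} {u₀ : EuclideanSpace ℝ (Fin 3) → EuclideanSpace ℝ (Fin 3)}

/-- A continuous function on `𝕋³` that is `≤ C` almost everywhere is `≤ C` everywhere (the superlevel
set is open and null, and Haar measure charges open sets). [folklore] -/
private theorem norm_le_of_ae_norm_le {g : UnitAddTorus (Fin 3) → EuclideanSpace ℝ (Fin 3)}
    (hg : Continuous g) {C : ℝ} (h : ∀ᵐ y : UnitAddTorus (Fin 3), ‖g y‖ ≤ C) (y : UnitAddTorus (Fin 3)) :
    ‖g y‖ ≤ C := by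
  by_contra hy
  have hopen : IsOpen {z : UnitAddTorus (Fin 3) | C < ‖g z‖} := isOpen_lt continuous_const hg.norm
  have hnull : volume {z : UnitAddTorus (Fin 3) | C < ‖g z‖} = 0 := by
    have h' := ae_iff.1 h
    simpa only [not_le] using h'
  have hemp := (hopen.measure_eq_zero_iff volume).1 hnull
  have : y ∈ {z : UnitAddTorus (Fin 3) | C < ‖g z‖} := not_le.1 hy
  rw [hemp] at this
  exact this

/-- **Hopf's global weak solution from a smooth divergence-free torus datum** (zero force): the tree's
`hopf_existence_torus_holds` applied to a smooth (hence `L²`, weakly divergence-free) datum.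
[cite: RobinsonRodrigoSadowskiCUP2016, Thm 4.10] [cite: Hopf1951, §1] -/
private theorem exists_isGlobalLerayHopf_of_smooth (hν : 0 < ν)
    {U₀ : UnitAddTorus (Fin 3) → EuclideanSpace ℝ (Fin 3)} (hs : Torus.IsSmooth U₀) (hd : Torus.IsDivFree U₀) :
    ∃ w : ℝ → UnitAddTorus (Fin 3) → EuclideanSpace ℝ (Fin 3), Torus.IsGlobalLerayHopf ν 0 U₀ w := by
  have hc : Continuous U₀ := hs.continuous
  obtain ⟨B, hB⟩ := isCompact_univ.exists_bound_of_continuousOn hc.continuousOn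
  have hL2 : MemLp U₀ 2 volume :=
    MemLp.of_bound hc.aestronglyMeasurable B (ae_of_all _ fun y => hB y (mem_univ y))
  have hwd : Torus.IsWeaklyDivFree U₀ :=
    Torus.IsDivFree.isWeaklyDivFree Torus.integral_inner_gradient_eq_neg_integral_mul_divergence_holds hs hd
  refine hopf_existence_torus_holds ν hν U₀ hL2 hwd 0 ?_ fun T _ => by simp
  exact aestronglyMeasurable_const

/-- **Per-datum Leray–Hopf door to printed-(10) solvability** (Serrin's `L^∞` class, datum-wise, on
`𝕋³`): for `ν > 0` and a smooth divergence-free `ℤ³`-periodic datum `u₀`, if every global Leray–Hopf weak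
solution of the unforced equations on `𝕋³` from the descended datum `y ↦ u₀ (repr y)` is essentially
bounded on some `(t₁, T) × 𝕋³`, `t₁ < T`, below every `T > 0`, then `(ν, 0, u₀)` is solvable in
Fefferman's class (10) (Hopf existence + weak–strong uniqueness against the maximal classical solution +
the velocity blow-up alternative).
[cite: FeffermanClay2006, (B) with (8) (10) (11) p. 2] [cite: Serrin1962, Thm (L^∞ case)] [cite: RobinsonRodrigoSadowskiCUP2016, Thm 6.10, Thm 8.17 with Lemma 8.16, §6.3, §8.1] -/
theorem clayPeriodic_solvable_of_lerayHopf_boundedFromLeft (hν : 0 < ν) (hu₀ : ContDiff ℝ ∞ u₀)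
    (hdiv : NSWave0.IsDivFree u₀) (hper : IsLatticePeriodic u₀)
    (h : ∀ w : ℝ → UnitAddTorus (Fin 3) → EuclideanSpace ℝ (Fin 3),
      Torus.IsGlobalLerayHopf ν 0 (fun y => u₀ (Torus.repr y)) w →
        ∀ T : ℝ, 0 < T → ∃ t₁ : ℝ, t₁ < T ∧ ∃ C : ℝ,
          ∀ᵐ t ∂(volume.restrict (Ioo t₁ T)), ∀ᵐ x : UnitAddTorus (Fin 3), ‖w t x‖ ≤ C) :
    clayPeriodic.Solvable ν 0 u₀ := by
  by_contra hno
  obtain ⟨Ts, hTs, u, p, hcl, hu0, hperT, hblow⟩ :=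
    (not_clayPeriodic_solvable_iff_exists_velocitySupBlowup hν hu₀ hdiv hper).1 hno
  -- descend the maximal solution to the torus
  obtain ⟨hU, hlift⟩ := torus_descend_of_periodic hcl hperT
  have h0S : (0 : ℝ) ∈ Ico 0 Ts := ⟨le_rfl, hTs⟩
  have hU0 : (fun y : UnitAddTorus (Fin 3) => u 0 (Torus.repr y)) = fun y => u₀ (Torus.repr y) := by
    funext y; rw [hu0]
  -- Hopf's global weak solution from the same datum
  obtain ⟨w, hw⟩ := exists_isGlobalLerayHopf_of_smooth hν (hU.smooth_velocity.isSmooth_slice h0S)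
    (hU.divFree 0 h0S)
  rw [hU0] at hw
  -- the hypothesis below `T*`
  obtain ⟨t₁, ht₁, C, hbd⟩ := h w hw Ts hTs
  -- weak–strong uniqueness on `(0, T*)`: `w(s) = u(s) ∘ repr` a.e.
  have hws : ∀ s ∈ Ioo 0 Ts, w s =ᵐ[volume] fun y => u s (Torus.repr y) := by
    intro s hs
    set s' : ℝ := (s + Ts) / 2 with hs'
    have hss' : s < s' := by rw [hs']; linarith [hs.2]
    have hs'T : s' < Ts := by rw [hs']; linarith [hs.2]
    have hs'0 : 0 < s' := hs.1.trans hss'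
    have hLH : Torus.IsLerayHopfOn s' ν 0 ((fun (t : ℝ) (y : UnitAddTorus (Fin 3)) => u t (Torus.repr y)) 0) w := by
      show Torus.IsLerayHopfOn s' ν 0 (fun y : UnitAddTorus (Fin 3) => u 0 (Torus.repr y)) w
      rw [hU0]; exact hw s' hs'0
    exact hLH.ae_eq_of_isClassicalNSSolutionOn hU (convex_Ico 0 Ts) (Icc_subset_Ico_right hs'T) hν.le
      hs'0 s ⟨hs.1, hss'.le⟩
  -- hence, for a.e. `s ∈ (t₁, T*) ∩ (0, T*)`, the classical slice is bounded by `C` EVERYWHERE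
  have hae : ∀ᵐ s ∂volume, s ∈ Ioo t₁ Ts → s ∈ Ioo 0 Ts →
      ∀ x : EuclideanSpace ℝ (Fin 3), ‖u s x‖ ≤ C := by
    have h1 : ∀ᵐ s ∂volume, s ∈ Ioo t₁ Ts → ∀ᵐ y : UnitAddTorus (Fin 3), ‖w s y‖ ≤ C :=
      (ae_restrict_iff' measurableSet_Ioo).1 hbd
    filter_upwards [h1] with s hs hs₁ hs₀ x
    have h2 : ∀ᵐ y : UnitAddTorus (Fin 3), ‖u s (Torus.repr y)‖ ≤ C := by
      filter_upwards [hs hs₁, hws s hs₀] with y hy hyw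
      rw [← hyw]; exact hy
    have hc : Continuous fun y : UnitAddTorus (Fin 3) => u s (Torus.repr y) :=
      (hU.smooth_velocity.isSmooth_slice (Ioo_subset_Ico_self hs₀)).continuous
    have h3 := norm_le_of_ae_norm_le hc h2 (Torus.proj x)
    have h4 : u s x = u s (Torus.repr (Torus.proj x)) := by
      have := congrFun (hlift s (Ioo_subset_Ico_self hs₀)) x
      rw [Torus.lift_apply] at this
      exact this.symm
    rw [h4]; exact h3
  -- a bound on the compact initial part `[0, t₂] × 𝕋³`, `t₂ = (max t₁ 0 + T*)/2`
  set t₂ : ℝ := (max t₁ 0 + Ts) / 2 with ht₂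
  have ht₂lt : t₂ < Ts := by
    rw [ht₂]; have := max_lt ht₁ hTs; linarith
  have ht₂gt₁ : t₁ < t₂ := by
    rw [ht₂]; have := le_max_left t₁ 0; linarith
  have ht₂gt0 : 0 < t₂ := by
    rw [ht₂]; have := le_max_right t₁ 0; linarith
  obtain ⟨M₀, hM₀⟩ := hU.smooth_velocity.exists_norm_le_of_isCompact isCompact_Icc
    (Icc_subset_Ico_right ht₂lt)
  -- the blow-up produces a time `t ∈ (t₂, T*)` and a point with `|u| > max M₀ C`
  obtain ⟨t, ht, x, hMx⟩ := hblow (max M₀ C)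
  have htgt : t₂ < t := by
    by_contra hle
    have h1 := hM₀ t ⟨ht.1, not_lt.1 hle⟩ (Torus.proj x)
    have h2 : u t x = u t (Torus.repr (Torus.proj x)) := by
      have := congrFun (hlift t ht) x
      rw [Torus.lift_apply] at this
      exact this.symm
    rw [← h2] at h1
    exact absurd ((le_max_left M₀ C).trans_lt hMx) (not_lt.2 h1)
  -- continuity in time at `(t, x)`: `|u(s, x)| > C` for `s` in a left-neighbourhood of `t`
  have hcont : ContinuousWithinAt (fun s => ‖u s x‖) (Ico 0 Ts) t := by
    have hc : ContinuousOn (uncurry u) (Ico 0 Ts ×ˢ univ) := hcl.smooth_velocity.continuousOn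
    have h1 : ContinuousWithinAt (uncurry u) (Ico 0 Ts ×ˢ univ) (t, x) := hc (t, x) (mk_mem_prod ht (mem_univ x))
    have h2 : ContinuousWithinAt (fun s : ℝ => ((s, x) : ℝ × EuclideanSpace ℝ (Fin 3))) (Ico 0 Ts) t :=
      (continuous_id.prodMk continuous_const).continuousWithinAt
    exact (ContinuousWithinAt.comp (f := fun s : ℝ => ((s, x) : ℝ × EuclideanSpace ℝ (Fin 3)))
      h1 h2 fun s hs => mk_mem_prod hs (mem_univ x)).norm
  have hCt : C < ‖u t x‖ := (le_max_right M₀ C).trans_lt hMx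
  obtain ⟨δ, hδ, hnear⟩ : ∃ δ > 0, ∀ s ∈ Ico 0 Ts, dist s t < δ → C < ‖u s x‖ := by
    have hev := hcont.eventually (isOpen_Ioi.mem_nhds hCt : Ioi C ∈ 𝓝 ‖u t x‖)
    rw [eventually_nhdsWithin_iff, Metric.eventually_nhds_iff] at hev
    obtain ⟨δ, hδ, hh⟩ := hev
    exact ⟨δ, hδ, fun s hs hd => hh hd hs⟩
  -- the interval `(max t₂ (t - δ), t)` has positive measure and lies where the a.e. bound holds
  set a : ℝ := max t₂ (t - δ) with ha
  have hat : a < t := max_lt htgt (by linarith)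
  have hpos : 0 < volume (Ioo a t) := by
    rw [Real.volume_Ioo]; exact ENNReal.ofReal_pos.2 (by linarith)
  have hnull : volume (Ioo a t) = 0 := by
    refine measure_eq_zero_iff_ae_notMem.2 ?_
    filter_upwards [hae] with s hs hsI
    have hs0 : 0 < s := ht₂gt0.trans ((le_max_left _ _).trans_lt hsI.1)
    have hsT : s < Ts := hsI.2.trans ht.2
    have hs₁ : t₁ < s := ht₂gt₁.trans ((le_max_left _ _).trans_lt hsI.1)
    have hle := hs ⟨hs₁, hsT⟩ ⟨hs0, hsT⟩ x
    have hds : dist s t < δ := by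
      rw [Real.dist_eq, abs_lt]
      constructor
      · linarith [(le_max_right t₂ (t - δ)).trans_lt hsI.1]
      · linarith [hsI.2]
    exact absurd (hnear s ⟨hs0.le, hsT⟩ hds) (not_lt.2 hle)
  exact absurd hnull hpos.ne'

/-- **(B) at one viscosity ⇔ the datum-wise Serrin `L^∞` criterion for Leray–Hopf solutions on `𝕋³`**:
`clayPeriodic.RegularityAt μ` ⇔ for every smooth divergence-free `ℤ³`-periodic datum `u₀`, every
global Leray–Hopf weak solution of the unforced equations on `𝕋³` from `u₀ ∘ repr` is essentially bounded
on some `(t₁, T) × 𝕋³`, `t₁ < T`, below every `T > 0` ((⇒): the global classical solution given by (B),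
read on `𝕋³`, is bounded on compact time intervals and equals every Leray–Hopf solution a.e.,
`Torus.IsGlobalLerayHopf.ae_eq_of_isClassicalNSSolutionOn_Ici`; (⇐):
`clayPeriodic_solvable_of_lerayHopf_boundedFromLeft`).
[cite: FeffermanClay2006, (B) with (8) (10) (11) p. 2] [cite: Serrin1962, Thm (L^∞ case)] [cite: RobinsonRodrigoSadowskiCUP2016, Thm 6.10] -/
theorem clayPeriodic_regularityAt_iff_lerayHopf_boundedFromLeft {μ : ℝ} (hμ : 0 < μ) :
    clayPeriodic.RegularityAt μ ↔
      ∀ (u₀ : EuclideanSpace ℝ (Fin 3) → EuclideanSpace ℝ (Fin 3)), ContDiff ℝ ∞ u₀ →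
        NSWave0.IsDivFree u₀ → IsLatticePeriodic u₀ →
        ∀ w : ℝ → UnitAddTorus (Fin 3) → EuclideanSpace ℝ (Fin 3),
          Torus.IsGlobalLerayHopf μ 0 (fun y => u₀ (Torus.repr y)) w →
            ∀ T : ℝ, 0 < T → ∃ t₁ : ℝ, t₁ < T ∧ ∃ C : ℝ,
              ∀ᵐ t ∂(volume.restrict (Ioo t₁ T)), ∀ᵐ x : UnitAddTorus (Fin 3), ‖w t x‖ ≤ C := by
  constructor
  · intro hreg u₀ hu₀ hdiv hper w hw T hT
    obtain ⟨U, P, hUc, hlift0⟩ := (clayPeriodic_solvable_zero_iff_torus μ hper).1 (hreg u₀ hu₀ hdiv hper)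
    -- the torus datum of the classical solution is `u₀ ∘ repr`
    have hU0 : U 0 = fun y => u₀ (Torus.repr y) := by
      have h1 : Torus.lift (U 0) = Torus.lift (Torus.descend u₀ hper) := by
        rw [hlift0, Torus.lift_descend_holds u₀ hper]
      exact Torus.lift_injective h1
    rw [← hU0] at hw
    obtain ⟨C, hC⟩ := hUc.smooth_velocity.exists_norm_le_of_isCompact isCompact_Icc
      (Icc_subset_Ici_self : Icc (0 : ℝ) T ⊆ Ici 0)
    refine ⟨0, hT, C, (ae_restrict_iff' measurableSet_Ioo).2 (ae_of_all _ fun t ht => ?_)⟩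
    filter_upwards [hw.ae_eq_of_isClassicalNSSolutionOn_Ici hUc hμ.le t ht.1] with y hy
    rw [hy]; exact hC t ⟨ht.1.le, ht.2.le⟩ y
  · intro hbd u₀ hu₀ hdiv hper
    exact clayPeriodic_solvable_of_lerayHopf_boundedFromLeft hμ hu₀ hdiv hper
      fun w hw T hT => hbd u₀ hu₀ hdiv hper w hw T hT

/-- **(B) ⇔ the datum-wise Serrin `L^∞` criterion for torus Leray–Hopf solutions at every viscosity.**
[cite: FeffermanClay2006, (B) with (8) (10) (11) p. 2] [cite: Serrin1962, Thm (L^∞ case)] -/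
theorem clayPeriodic_regularity_iff_lerayHopf_boundedFromLeft :
    clayPeriodic.Regularity ↔
      ∀ μ : ℝ, 0 < μ →
      ∀ (u₀ : EuclideanSpace ℝ (Fin 3) → EuclideanSpace ℝ (Fin 3)), ContDiff ℝ ∞ u₀ →
        NSWave0.IsDivFree u₀ → IsLatticePeriodic u₀ →
        ∀ w : ℝ → UnitAddTorus (Fin 3) → EuclideanSpace ℝ (Fin 3),
          Torus.IsGlobalLerayHopf μ 0 (fun y => u₀ (Torus.repr y)) w →
            ∀ T : ℝ, 0 < T → ∃ t₁ : ℝ, t₁ < T ∧ ∃ C : ℝ,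
              ∀ᵐ t ∂(volume.restrict (Ioo t₁ T)), ∀ᵐ x : UnitAddTorus (Fin 3), ‖w t x‖ ≤ C :=
  ⟨fun h μ hμ => (clayPeriodic_regularityAt_iff_lerayHopf_boundedFromLeft hμ).1 (h μ hμ),
    fun h μ hμ => (clayPeriodic_regularityAt_iff_lerayHopf_boundedFromLeft hμ).2 (h μ hμ)⟩

/-- **(B) ⇔ the datum-wise Serrin `L^∞` criterion at ONE viscosity `μ > 0`.**
[cite: FeffermanClay2006, (B) p. 2] [cite: Tao2013Localisation, Rem. 1.2 footnote] -/
theorem clayPeriodic_regularity_iff_lerayHopf_boundedFromLeft_at {μ : ℝ} (hμ : 0 < μ) :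
    clayPeriodic.Regularity ↔
      ∀ (u₀ : EuclideanSpace ℝ (Fin 3) → EuclideanSpace ℝ (Fin 3)), ContDiff ℝ ∞ u₀ →
        NSWave0.IsDivFree u₀ → IsLatticePeriodic u₀ →
        ∀ w : ℝ → UnitAddTorus (Fin 3) → EuclideanSpace ℝ (Fin 3),
          Torus.IsGlobalLerayHopf μ 0 (fun y => u₀ (Torus.repr y)) w →
            ∀ T : ℝ, 0 < T → ∃ t₁ : ℝ, t₁ < T ∧ ∃ C : ℝ,
              ∀ᵐ t ∂(volume.restrict (Ioo t₁ T)), ∀ᵐ x : UnitAddTorus (Fin 3), ‖w t x‖ ≤ C := by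
  rw [← ClaySpec.regularityAt_iff_regularity hμ clayPeriodic_data_smul
    clayPeriodic_admissible_timeRescale]
  exact clayPeriodic_regularityAt_iff_lerayHopf_boundedFromLeft hμ

/-! ## Rev 2 (keeper `ns-claims-lit-4` g9, ADDITIVE — nothing above is touched): PER-SOLUTION doors

The doors above quantify over EVERY global Leray–Hopf weak solution from the datum. Manuscripts of the
«construct a Leray–Hopf limit and show IT is classical» type (Galerkin / regularised schemes on `𝕋³`) deliver
ONE global Leray–Hopf solution with a regularity property. One is enough: weak–strong uniqueness is applied
to the GIVEN solution against the maximal classical solution from the smooth datum, exactly as in the proof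
of `clayPeriodic_solvable_of_lerayHopf_boundedFromLeft` (whose Hopf-existence line is the only line dropped).
This is the (B)-side twin of the `ℝ³` door `clay_solution_of_locallyBounded_globalLerayHopf`. -/

/-- **Per-SOLUTION Leray–Hopf door to printed-(10) solvability**: for `ν > 0` and a smooth divergence-free
`ℤ³`-periodic datum `u₀`, if SOME global Leray–Hopf weak solution `w` of the unforced equations on `𝕋³` from
the descended datum `y ↦ u₀ (repr y)` is essentially bounded on some `(t₁, T) × 𝕋³`, `t₁ < T`, below every
`T > 0`, then `(ν, 0, u₀)` is solvable in Fefferman's class (10) (weak–strong uniqueness of `w` against the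
maximal classical solution + the velocity blow-up alternative; no Hopf existence needed).
[cite: FeffermanClay2006, (B) with (8) (10) (11) p. 2] [cite: Serrin1962, Thm (L^∞ case)]
[cite: RobinsonRodrigoSadowskiCUP2016, Thm 6.10, Thm 8.17 with Lemma 8.16, §6.3, §8.1] -/
theorem clayPeriodic_solvable_of_isGlobalLerayHopf_boundedFromLeft (hν : 0 < ν) (hu₀ : ContDiff ℝ ∞ u₀)
    (hdiv : NSWave0.IsDivFree u₀) (hper : IsLatticePeriodic u₀)
    {w : ℝ → UnitAddTorus (Fin 3) → EuclideanSpace ℝ (Fin 3)}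
    (hw : Torus.IsGlobalLerayHopf ν 0 (fun y => u₀ (Torus.repr y)) w)
    (h : ∀ T : ℝ, 0 < T → ∃ t₁ : ℝ, t₁ < T ∧ ∃ C : ℝ,
      ∀ᵐ t ∂(volume.restrict (Ioo t₁ T)), ∀ᵐ x : UnitAddTorus (Fin 3), ‖w t x‖ ≤ C) :
    clayPeriodic.Solvable ν 0 u₀ := by
  by_contra hno
  obtain ⟨Ts, hTs, u, p, hcl, hu0, hperT, hblow⟩ :=
    (not_clayPeriodic_solvable_iff_exists_velocitySupBlowup hν hu₀ hdiv hper).1 hno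
  -- descend the maximal solution to the torus
  obtain ⟨hU, hlift⟩ := torus_descend_of_periodic hcl hperT
  have h0S : (0 : ℝ) ∈ Ico 0 Ts := ⟨le_rfl, hTs⟩
  have hU0 : (fun y : UnitAddTorus (Fin 3) => u 0 (Torus.repr y)) = fun y => u₀ (Torus.repr y) := by
    funext y; rw [hu0]
  -- the hypothesis below `T*`
  obtain ⟨t₁, ht₁, C, hbd⟩ := h Ts hTs
  -- weak–strong uniqueness on `(0, T*)`: `w(s) = u(s) ∘ repr` a.e.
  have hws : ∀ s ∈ Ioo 0 Ts, w s =ᵐ[volume] fun y => u s (Torus.repr y) := by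
    intro s hs
    set s' : ℝ := (s + Ts) / 2 with hs'
    have hss' : s < s' := by rw [hs']; linarith [hs.2]
    have hs'T : s' < Ts := by rw [hs']; linarith [hs.2]
    have hs'0 : 0 < s' := hs.1.trans hss'
    have hLH : Torus.IsLerayHopfOn s' ν 0 ((fun (t : ℝ) (y : UnitAddTorus (Fin 3)) => u t (Torus.repr y)) 0) w := by
      show Torus.IsLerayHopfOn s' ν 0 (fun y : UnitAddTorus (Fin 3) => u 0 (Torus.repr y)) w
      rw [hU0]; exact hw s' hs'0
    exact hLH.ae_eq_of_isClassicalNSSolutionOn hU (convex_Ico 0 Ts) (Icc_subset_Ico_right hs'T) hν.le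
      hs'0 s ⟨hs.1, hss'.le⟩
  -- hence, for a.e. `s ∈ (t₁, T*) ∩ (0, T*)`, the classical slice is bounded by `C` EVERYWHERE
  have hae : ∀ᵐ s ∂volume, s ∈ Ioo t₁ Ts → s ∈ Ioo 0 Ts →
      ∀ x : EuclideanSpace ℝ (Fin 3), ‖u s x‖ ≤ C := by
    have h1 : ∀ᵐ s ∂volume, s ∈ Ioo t₁ Ts → ∀ᵐ y : UnitAddTorus (Fin 3), ‖w s y‖ ≤ C :=
      (ae_restrict_iff' measurableSet_Ioo).1 hbd
    filter_upwards [h1] with s hs hs₁ hs₀ x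
    have h2 : ∀ᵐ y : UnitAddTorus (Fin 3), ‖u s (Torus.repr y)‖ ≤ C := by
      filter_upwards [hs hs₁, hws s hs₀] with y hy hyw
      rw [← hyw]; exact hy
    have hc : Continuous fun y : UnitAddTorus (Fin 3) => u s (Torus.repr y) :=
      (hU.smooth_velocity.isSmooth_slice (Ioo_subset_Ico_self hs₀)).continuous
    have h3 := norm_le_of_ae_norm_le hc h2 (Torus.proj x)
    have h4 : u s x = u s (Torus.repr (Torus.proj x)) := by
      have := congrFun (hlift s (Ioo_subset_Ico_self hs₀)) x
      rw [Torus.lift_apply] at this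
      exact this.symm
    rw [h4]; exact h3
  -- a bound on the compact initial part `[0, t₂] × 𝕋³`, `t₂ = (max t₁ 0 + T*)/2`
  set t₂ : ℝ := (max t₁ 0 + Ts) / 2 with ht₂
  have ht₂lt : t₂ < Ts := by
    rw [ht₂]; have := max_lt ht₁ hTs; linarith
  have ht₂gt₁ : t₁ < t₂ := by
    rw [ht₂]; have := le_max_left t₁ 0; linarith
  have ht₂gt0 : 0 < t₂ := by
    rw [ht₂]; have := le_max_right t₁ 0; linarith
  obtain ⟨M₀, hM₀⟩ := hU.smooth_velocity.exists_norm_le_of_isCompact isCompact_Icc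
    (Icc_subset_Ico_right ht₂lt)
  -- the blow-up produces a time `t ∈ (t₂, T*)` and a point with `|u| > max M₀ C`
  obtain ⟨t, ht, x, hMx⟩ := hblow (max M₀ C)
  have htgt : t₂ < t := by
    by_contra hle
    have h1 := hM₀ t ⟨ht.1, not_lt.1 hle⟩ (Torus.proj x)
    have h2 : u t x = u t (Torus.repr (Torus.proj x)) := by
      have := congrFun (hlift t ht) x
      rw [Torus.lift_apply] at this
      exact this.symm
    rw [← h2] at h1
    exact absurd ((le_max_left M₀ C).trans_lt hMx) (not_lt.2 h1)
  -- continuity in time at `(t, x)`: `|u(s, x)| > C` for `s` in a left-neighbourhood of `t`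
  have hcont : ContinuousWithinAt (fun s => ‖u s x‖) (Ico 0 Ts) t := by
    have hc : ContinuousOn (uncurry u) (Ico 0 Ts ×ˢ univ) := hcl.smooth_velocity.continuousOn
    have h1 : ContinuousWithinAt (uncurry u) (Ico 0 Ts ×ˢ univ) (t, x) := hc (t, x) (mk_mem_prod ht (mem_univ x))
    have h2 : ContinuousWithinAt (fun s : ℝ => ((s, x) : ℝ × EuclideanSpace ℝ (Fin 3))) (Ico 0 Ts) t :=
      (continuous_id.prodMk continuous_const).continuousWithinAt
    exact (ContinuousWithinAt.comp (f := fun s : ℝ => ((s, x) : ℝ × EuclideanSpace ℝ (Fin 3)))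
      h1 h2 fun s hs => mk_mem_prod hs (mem_univ x)).norm
  have hCt : C < ‖u t x‖ := (le_max_right M₀ C).trans_lt hMx
  obtain ⟨δ, hδ, hnear⟩ : ∃ δ > 0, ∀ s ∈ Ico 0 Ts, dist s t < δ → C < ‖u s x‖ := by
    have hev := hcont.eventually (isOpen_Ioi.mem_nhds hCt : Ioi C ∈ 𝓝 ‖u t x‖)
    rw [eventually_nhdsWithin_iff, Metric.eventually_nhds_iff] at hev
    obtain ⟨δ, hδ, hh⟩ := hev
    exact ⟨δ, hδ, fun s hs hd => hh hd hs⟩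
  -- the interval `(max t₂ (t - δ), t)` has positive measure and lies where the a.e. bound holds
  set a : ℝ := max t₂ (t - δ) with ha
  have hat : a < t := max_lt htgt (by linarith)
  have hpos : 0 < volume (Ioo a t) := by
    rw [Real.volume_Ioo]; exact ENNReal.ofReal_pos.2 (by linarith)
  have hnull : volume (Ioo a t) = 0 := by
    refine measure_eq_zero_iff_ae_notMem.2 ?_
    filter_upwards [hae] with s hs hsI
    have hs0 : 0 < s := ht₂gt0.trans ((le_max_left _ _).trans_lt hsI.1)
    have hsT : s < Ts := hsI.2.trans ht.2
    have hs₁ : t₁ < s := ht₂gt₁.trans ((le_max_left _ _).trans_lt hsI.1)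
    have hle := hs ⟨hs₁, hsT⟩ ⟨hs0, hsT⟩ x
    have hds : dist s t < δ := by
      rw [Real.dist_eq, abs_lt]
      constructor
      · linarith [(le_max_right t₂ (t - δ)).trans_lt hsI.1]
      · linarith [hsI.2]
    exact absurd (hnear s ⟨hs0.le, hsT⟩ hds) (not_lt.2 hle)
  exact absurd hnull hpos.ne'

/-- **Per-SOLUTION a.e.-classical door**: if SOME global Leray–Hopf weak solution `w` on `𝕋³` from the
descended smooth datum agrees, at every `t > 0`, almost everywhere with a classical solution `(U, P)` on
`𝕋³ × (0, ∞)` («the Leray–Hopf limit is smooth for t > 0»), then `(ν, 0, u₀)` is solvable in Fefferman's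
class (10): `U` is bounded on every compact `[T/2, T] × 𝕋³`, so `w` is essentially bounded from the left below
every `T > 0`, and `clayPeriodic_solvable_of_isGlobalLerayHopf_boundedFromLeft` concludes.
[cite: FeffermanClay2006, (B) with (8) (10) (11) p. 2] [cite: Serrin1962, Thm (L^∞ case)] -/
theorem clayPeriodic_solvable_of_isGlobalLerayHopf_aeClassical (hν : 0 < ν) (hu₀ : ContDiff ℝ ∞ u₀)
    (hdiv : NSWave0.IsDivFree u₀) (hper : IsLatticePeriodic u₀)
    {w : ℝ → UnitAddTorus (Fin 3) → EuclideanSpace ℝ (Fin 3)}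
    (hw : Torus.IsGlobalLerayHopf ν 0 (fun y => u₀ (Torus.repr y)) w)
    {U : ℝ → UnitAddTorus (Fin 3) → EuclideanSpace ℝ (Fin 3)} {P : ℝ → UnitAddTorus (Fin 3) → ℝ}
    (hU : Torus.IsClassicalNSSolutionOn (Ioi 0) ν 0 U P) (hagree : ∀ t : ℝ, 0 < t → w t =ᵐ[volume] U t) :
    clayPeriodic.Solvable ν 0 u₀ := by
  refine clayPeriodic_solvable_of_isGlobalLerayHopf_boundedFromLeft hν hu₀ hdiv hper hw fun T hT => ?_
  have hsub : Icc (T / 2) T ⊆ Ioi (0 : ℝ) := fun t ht => lt_of_lt_of_le (half_pos hT) ht.1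
  obtain ⟨C, hC⟩ := hU.smooth_velocity.exists_norm_le_of_isCompact isCompact_Icc hsub
  refine ⟨T / 2, by linarith, C, (ae_restrict_iff' measurableSet_Ioo).2 (ae_of_all _ fun t ht => ?_)⟩
  filter_upwards [hagree t ((half_pos hT).trans ht.1)] with y hy
  rw [hy]; exact hC t ⟨ht.1.le, ht.2.le⟩ y

/-- **The same with the Leray–Hopf solution ITSELF classical on `𝕋³ × (0, ∞)`.**
[cite: FeffermanClay2006, (B) with (8) (10) (11) p. 2] [cite: Serrin1962, Thm (L^∞ case)] -/
theorem clayPeriodic_solvable_of_isGlobalLerayHopf_classical (hν : 0 < ν) (hu₀ : ContDiff ℝ ∞ u₀)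
    (hdiv : NSWave0.IsDivFree u₀) (hper : IsLatticePeriodic u₀)
    {w : ℝ → UnitAddTorus (Fin 3) → EuclideanSpace ℝ (Fin 3)} {q : ℝ → UnitAddTorus (Fin 3) → ℝ}
    (hw : Torus.IsGlobalLerayHopf ν 0 (fun y => u₀ (Torus.repr y)) w)
    (hcl : Torus.IsClassicalNSSolutionOn (Ioi 0) ν 0 w q) : clayPeriodic.Solvable ν 0 u₀ :=
  clayPeriodic_solvable_of_isGlobalLerayHopf_aeClassical hν hu₀ hdiv hper hw hcl
    fun _ _ => Filter.EventuallyEq.rfl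

/-! ### Torus-datum phrasing (data `U₀ : 𝕋³ → ℝ³`, `Torus.IsSmooth`, `Torus.IsDivFree`; the Clay datum is
the lift `Torus.lift U₀`, and `U₀ = fun y => Torus.lift U₀ (repr y)`) -/

/-- The descended datum of a lift is the torus datum: `(y ↦ lift U₀ (repr y)) = U₀`. [folklore] -/
private theorem lift_comp_repr (U₀ : UnitAddTorus (Fin 3) → EuclideanSpace ℝ (Fin 3)) :
    (fun y => Torus.lift U₀ (Torus.repr y)) = U₀ := by
  funext y
  rw [Torus.lift_apply, Torus.proj_repr]

/-- **Torus-datum per-solution a.e.-classical door**: a smooth divergence-free datum `U₀` on `𝕋³`, SOME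
global Leray–Hopf weak solution `w` from `U₀` agreeing at every `t > 0` a.e. with a classical solution on
`𝕋³ × (0, ∞)` ⇒ the lifted Cauchy problem `(ν, 0, Torus.lift U₀)` is solvable in Fefferman's class (10) —
equivalently (`clayPeriodic_solvable_lift_iff`) `U₀` launches a global classical solution on `𝕋³ × [0,∞)`.
[cite: FeffermanClay2006, (B) with (8) (10) (11) p. 2] [cite: Serrin1962, Thm (L^∞ case)] -/
theorem clayPeriodic_solvable_lift_of_isGlobalLerayHopf_aeClassical (hν : 0 < ν)
    {U₀ : UnitAddTorus (Fin 3) → EuclideanSpace ℝ (Fin 3)} (hs : Torus.IsSmooth U₀) (hd : Torus.IsDivFree U₀)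
    {w : ℝ → UnitAddTorus (Fin 3) → EuclideanSpace ℝ (Fin 3)} (hw : Torus.IsGlobalLerayHopf ν 0 U₀ w)
    {U : ℝ → UnitAddTorus (Fin 3) → EuclideanSpace ℝ (Fin 3)} {P : ℝ → UnitAddTorus (Fin 3) → ℝ}
    (hU : Torus.IsClassicalNSSolutionOn (Ioi 0) ν 0 U P) (hagree : ∀ t : ℝ, 0 < t → w t =ᵐ[volume] U t) :
    clayPeriodic.Solvable ν 0 (Torus.lift U₀) := by
  have hw' : Torus.IsGlobalLerayHopf ν 0 (fun y => Torus.lift U₀ (Torus.repr y)) w := by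
    rw [lift_comp_repr]; exact hw
  exact clayPeriodic_solvable_of_isGlobalLerayHopf_aeClassical hν ((contDiff_lift_iff_isSmooth U₀).2 hs)
    ((isDivFree_lift_iff_torus hs).2 hd) (Torus.isLatticePeriodic_lift U₀) hw' hU hagree

/-- **Torus-datum per-solution door, global classical conclusion**: under the same hypotheses `U₀` launches a
global classical solution on `𝕋³ × [0, ∞)`. [cite: FeffermanClay2006, (B) with (8) (10) (11) p. 2] -/
theorem exists_torus_classical_of_isGlobalLerayHopf_aeClassical (hν : 0 < ν)
    {U₀ : UnitAddTorus (Fin 3) → EuclideanSpace ℝ (Fin 3)} (hs : Torus.IsSmooth U₀) (hd : Torus.IsDivFree U₀)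
    {w : ℝ → UnitAddTorus (Fin 3) → EuclideanSpace ℝ (Fin 3)} (hw : Torus.IsGlobalLerayHopf ν 0 U₀ w)
    {U : ℝ → UnitAddTorus (Fin 3) → EuclideanSpace ℝ (Fin 3)} {P : ℝ → UnitAddTorus (Fin 3) → ℝ}
    (hU : Torus.IsClassicalNSSolutionOn (Ioi 0) ν 0 U P) (hagree : ∀ t : ℝ, 0 < t → w t =ᵐ[volume] U t) :
    ∃ (V : ℝ → UnitAddTorus (Fin 3) → EuclideanSpace ℝ (Fin 3)) (Q : ℝ → UnitAddTorus (Fin 3) → ℝ),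
      Torus.IsClassicalNSSolutionOn (Ici 0) ν 0 V Q ∧ V 0 = U₀ :=
  (clayPeriodic_solvable_lift_iff ν U₀).1
    (clayPeriodic_solvable_lift_of_isGlobalLerayHopf_aeClassical hν hs hd hw hU hagree)

/-- **(B) at one viscosity FROM «for every smooth divergence-free datum on `𝕋³` SOME global Leray–Hopf weak
solution is a.e.-classical on (0, ∞)»** — the door for Galerkin/regularised-limit manuscripts («the
Leray–Hopf limit u is a global classical solution», read as smooth for `t > 0`), binder-free.
[cite: FeffermanClay2006, (B) with (8) (10) (11) p. 2] [cite: Serrin1962, Thm (L^∞ case)]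
[cite: RobinsonRodrigoSadowskiCUP2016, Thm 6.10, Thm 8.17] -/
theorem clayPeriodic_regularityAt_of_torus_lerayHopf_aeClassical {μ : ℝ} (hμ : 0 < μ)
    (h : ∀ U₀ : UnitAddTorus (Fin 3) → EuclideanSpace ℝ (Fin 3), Torus.IsSmooth U₀ → Torus.IsDivFree U₀ →
      ∃ (w : ℝ → UnitAddTorus (Fin 3) → EuclideanSpace ℝ (Fin 3))
        (U : ℝ → UnitAddTorus (Fin 3) → EuclideanSpace ℝ (Fin 3)) (P : ℝ → UnitAddTorus (Fin 3) → ℝ),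
        Torus.IsGlobalLerayHopf μ 0 U₀ w ∧ Torus.IsClassicalNSSolutionOn (Ioi 0) μ 0 U P ∧
          ∀ t : ℝ, 0 < t → w t =ᵐ[volume] U t) :
    clayPeriodic.RegularityAt μ := by
  refine (clayPeriodic_regularityAt_iff_torus hμ).2 fun U₀ hs hd => ?_
  obtain ⟨w, U, P, hw, hU, hagree⟩ := h U₀ hs hd
  exact exists_torus_classical_of_isGlobalLerayHopf_aeClassical hμ hs hd hw hU hagree

/-- **… and (B) at every viscosity** (one `μ > 0` suffices by `ClaySpec.regularityAt_iff_regularity`).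
[cite: FeffermanClay2006, (B) with (8) (10) (11) p. 2] -/
theorem clayPeriodic_regularity_of_torus_lerayHopf_aeClassical {μ : ℝ} (hμ : 0 < μ)
    (h : ∀ U₀ : UnitAddTorus (Fin 3) → EuclideanSpace ℝ (Fin 3), Torus.IsSmooth U₀ → Torus.IsDivFree U₀ →
      ∃ (w : ℝ → UnitAddTorus (Fin 3) → EuclideanSpace ℝ (Fin 3))
        (U : ℝ → UnitAddTorus (Fin 3) → EuclideanSpace ℝ (Fin 3)) (P : ℝ → UnitAddTorus (Fin 3) → ℝ),
        Torus.IsGlobalLerayHopf μ 0 U₀ w ∧ Torus.IsClassicalNSSolutionOn (Ioi 0) μ 0 U P ∧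
          ∀ t : ℝ, 0 < t → w t =ᵐ[volume] U t) :
    clayPeriodic.Regularity :=
  (ClaySpec.regularityAt_iff_regularity hμ clayPeriodic_data_smul clayPeriodic_admissible_timeRescale).1
    (clayPeriodic_regularityAt_of_torus_lerayHopf_aeClassical hμ h)

end

end Literature.Claims.NS.ClayVariants

-- WHAT THIS IS NOT: not a claim about NS regularity or blow-up; not a claim about any author beyond
-- the typed locator.
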